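import Summits.ResolutionOfSingularities.ResolutionOfSingularities.Theses.FrobeniusLadder

/-!
# Route FrobeniusLadder — Assembly (item stmt-ResolutionOfSingularities-15336)

The assembly item of route `FrobeniusLadder` reads

  `Assembly := FInjectiveMacaulayfication → FRationalModification → FRationalResolution →
    ResolutionOfSingularities`,

which is literally the type of the route's deciding theorem `closes`: unfold
`ResolutionOfSingularities_iff`, fix a prime `p`, a field `k` of characteristic `p` and a reduced
separated finite-type `X/k`, and chain the three rungs `FRationalResolution ∘ FRationalModification ∘
FInjectiveMacaulayfication` at that `X`. All the mathematics of the route lives in the three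
hypotheses (items stmt-15315, stmt-15316, stmt-15317); this file only records that the route closes.
We give the chain explicitly (rather than `exact closes`) so that the file does not depend on the
gate-regenerated deciding theorem keeping its name.
-/

-- single-problem summit: the doubled namespace component `ResolutionOfSingularities` is forced
set_option linter.dupNamespace false

namespace Summit.ResolutionOfSingularities.ResolutionOfSingularities.Theorems

open Summit.ResolutionOfSingularities.ResolutionOfSingularities.Theses.FrobeniusLadder

/-- **Assembly of route FrobeniusLadder** (item stmt-ResolutionOfSingularities-15336):
F-injective Macaulayfication of every reduced separated finite-type scheme over every field of
every prime characteristic (`FInjectiveMacaulayfication`), F-rationalification of schemes with a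
CM F-injective proper birational model (`FRationalModification`) and resolution of schemes with an
F-rational proper birational model (`FRationalResolution`) together give
`ResolutionOfSingularities`. Proof: modus ponens three times at each `(p, k, X, f)`. [folklore] -/
theorem frobeniusLadder_assembly_proof :
    Summit.ResolutionOfSingularities.ResolutionOfSingularities.Theses.FrobeniusLadder.Assembly := by
  unfold Assembly
  intro hFI hFR hRes
  rw [_root_.ResolutionOfSingularities_iff]
  intro p hp k _ _ X f hsep hft hqc hred
  exact hRes p hp k X f hsep hft hqc hred
    (hFR p hp k X f hsep hft hqc hred (hFI p hp k X f hsep hft hqc hred))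

end Summit.ResolutionOfSingularities.ResolutionOfSingularities.Theorems
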